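import Summits.BirchSwinnertonDyer.BirchSwinnertonDyer.Theorems.ThetaPartnerAtTwoSignedKatoUpToAtTwoFineSandwich
import Literature.NumberTheory.EllipticCurves.CyclotomicZpExtensionLocalGeneratorProofs
import Literature.NumberTheory.EllipticCurves.FineSelmerTorsionCoefficientsFiniteProofs
import Literature.NumberTheory.EllipticCurves.SemistableModPImageAbelianProofs
import HarnessLib

/-!
# Route `ThetaPartnerAtTwo` (TP2), crux K3 `SignedKatoDivisibilityUpToAtTwo` (item stmt-BirchSwinnertonDyer-20308),
# line `colemanrat` v3 — «locally trivial above `p`» over the CYCLOTOMIC `ℤ_p`-extension of `ℚ` is ONE condition: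
# `Str_p(s) ⟺ res_𝔭 s = 0` in `H¹(ℚ_{∞,𝔭}, E[p^∞])` at the unique prime `𝔭` of `ℚ_∞` above `p` (so the local module of
# K3's (PT) clause is ONE copy of the local cohomology at `𝔭`, not a product over conjugates)

Width seat `bsd-wall-tp2-p2x-w3` g2 (cell `bsd-wall`). HONEST FRAMING: THEOREMS ONLY — no definition, no named fact, no
instance, no `sorry`; route-independent (no `Theses` import); closes no item; BSD is NOT proved by any of this.

## Why this file

`…FineSandwich` / `…OffTwoLocalPackage` spell «`s ∈ Sel^ε(E/K_∞)` is locally trivial above `p`» (`Str_p(s)`) as the tree's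
fine-datum strict condition at EVERY place `v ∋ p` of `K` and EVERY conjugate `conj_σ s`, `σ ∈ Γ_K` (the shape of
`GreenbergSelmer.strictSelmerGroupOver`). For K3 (`K = ℚ`, `κ` cyclotomic) this collapses to a single vanishing
`res_{Gal(ℚ̄/ℚ_∞) ⊓ D_p} s = 0`: (i) `ℚ` has ONE place above `p`; (ii) the fine datum's strict kernel at `v` IS «restriction to
`H ⊓ D_v` vanishes» (`M⁺_v = 0`, so `M → M/M⁺_v` is injective); (iii) `p` is TOTALLY RAMIFIED in `ℚ_∞/ℚ` — the decomposition
group surjects onto `Gal(ℚ_∞/ℚ)` (tree: `ZpExtension.IsCyclotomic.exists_apply_resGalOfEmb_adicCompletion_eq`), so every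
`σ ∈ Γ_ℚ` is `δ·h` with `δ ∈ D_p`, `h ∈ Gal(ℚ̄/ℚ_∞)`; `conj_h` is the identity on `H¹(ℚ_∞, ·)` and `conj_δ` preserves
«`res_{H ⊓ D_p} = 0`» (tree: `resOfLe_conjH1_eq_zero_of_mem`). Kobayashi, §2 p. 4: «the prime `p` is totally ramified in `K_n`»;
(7.17) has ONE local term `H¹(k_n, T)/H¹_±` at `p`.

## What is proved

* §1 (tree) `heightOneSpectrum_eq_of_natCast_mem` — two finite places of `ℚ` containing the prime `p` are equal.
* §2 `mem_strictKer_fineData_iff` (any number field `K`, any `H`, `v`) — `c ∈ strictKer(fine, v) ↔ res_{H ⊓ D_v} c = 0`.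
* §3 `resOfLe_conjH1_eq_zero_of_isCyclotomic_rat` — `K = ℚ`, `κ` cyclotomic, `v ∋ p`: `res_{H ⊓ D_v} s = 0 ⟹ res_{H ⊓ D_v}(conj_σ s) = 0`
  for EVERY `σ ∈ Γ_ℚ`; `strictAt_iff_resOfLe_eq_zero_rat` — **`Str_p(s) ⟺ res_{H ⊓ D_v} s = 0`**.
* §4 the sandwich and the dual statements of `…FineSandwich` in this one-condition currency (`K = ℚ`, cyclotomic `κ`, any `p`, `ε`):
  `two_nsmul_mem_fineSelmerInfty_of_resOfLe_eq_zero_rat`, `mem_fineSelmerInfty_iff_resOfLe_eq_zero_rat_of_odd`,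
  `toDual_two_nsmul_apply_eq_zero_of_resOfLe_eq_zero_rat`.

References: [Kobayashi2003] §2 p. 4, Def. 1.1, (7.17) (p. 12); [Washington1997] §13.1 (`p` totally ramified in `ℚ_∞`);
[Greenberg1989] §1 p. 98; [SerreGaloisCohomology1997] I §2.5, I §5.1 (conjugation acts trivially); [LimSujatha2018] §3.
-/

set_option autoImplicit false
-- the Theorems namespace of this sub repeats the summit name by design (D-0017 nested layout)
set_option linter.dupNamespace false

noncomputable section

open scoped Classical

namespace Summit.BirchSwinnertonDyer.BirchSwinnertonDyer.Theorems

namespace SignedKatoOffTwo.FineStrictRat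

open WeierstrassCurve NumberField IsDedekindDomain Field Literature.NumberTheory.EllipticCurves
  Literature.NumberTheory.EllipticCurves.Kobayashi2003 Literature.NumberTheory.EllipticCurves.GreenbergSelmer
  Literature.NumberTheory.GaloisRepresentations ZpExtension

universe u

/-! ## §1 `ℚ` has one place above `p`: the tree's `heightOneSpectrum_eq_of_natCast_mem` (`SemistableModPImageAbelianProofs`) -/

/-! ## §2 The fine datum's strict kernel is «restriction to `H ⊓ D_v` vanishes» -/

section Strict

variable {K : Type u} [Field K] [NumberField K] (W : WeierstrassCurve K) (p : ℕ)
  (H : Subgroup (absoluteGaloisGroup K))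

/-- **`c ∈ strictKer(fine datum at v) ↔ res_{H ⊓ D_v} c = 0`** (`M⁺_v = 0`: the strict map is the restriction to the
decomposition group followed by the INJECTIVE `M → M/0`). `→` is the tree's
`resOfLe_inf_decomp_eq_zero_of_mem_strictKer_fineLocalDatum`. [cite: Greenberg1989, §1 p. 98] -/
theorem mem_strictKer_fineData_iff (v : HeightOneSpectrum (𝓞 K)) (hv : ((p : ℕ) : 𝓞 K) ∈ v.asIdeal)
    (c : W.subgroupH1 p H) :
    c ∈ (fineData (W.geomPrimaryTorsion p) p v hv).strictKer H ↔
      resOfLe (W.geomPrimaryTorsion p) (inf_le_left : H ⊓ decomp v ≤ H) c = 0 := by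
  refine ⟨fun hc ↦ resOfLe_inf_decomp_eq_zero_of_mem_strictKer_fineLocalDatum W p v hc, fun hc ↦ ?_⟩
  obtain ⟨φ, rfl⟩ := oneCocycleClass_surjective _ c
  rw [Literature.NumberTheory.EllipticCurves.resOfLe, resH1Hom_oneCocycleClass, oneCocycleClass_eq_zero_iff] at hc
  obtain ⟨t, ht⟩ := hc
  show oneCocycleClass _ φ ∈ (fineLocalDatum (W.geomPrimaryTorsion p) v).strictKer H
  rw [LocalDatum.mem_strictKer_iff, LocalDatum.strictMap, resH1Hom_oneCocycleClass, oneCocycleClass_eq_zero_iff]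
  refine ⟨(fineLocalDatum (W.geomPrimaryTorsion p) v).grMk t, fun x ↦ ?_⟩
  have hx : ((x : decomp (K := K) v) : absoluteGaloisGroup K) ∈ H ⊓ decomp v :=
    Subgroup.mem_inf.2 ⟨(mem_decompIn_iff H v _).1 x.2, (x : decomp (K := K) v).2⟩
  have h1 := ht ⟨((x : decomp (K := K) v) : absoluteGaloisGroup K), hx⟩
  have h1' : φ.1 ⟨((x : decomp (K := K) v) : absoluteGaloisGroup K), (Subgroup.mem_inf.1 hx).1⟩ =
      ((x : decomp (K := K) v) : absoluteGaloisGroup K) • t - t := h1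
  show (fineLocalDatum (W.geomPrimaryTorsion p) v).grMk (φ.1 ⟨((x : decomp (K := K) v) : absoluteGaloisGroup K), _⟩) = _
  rw [h1', map_sub]
  rfl

end Strict

/-! ## §3 `K = ℚ`, cyclotomic `κ`: all conjugates from one condition -/

section Rat

variable (W : WeierstrassCurve ℚ) {p : ℕ} [Fact p.Prime] (κ : ZpExtension ℚ p)

/-- **`p` totally ramified in `ℚ_∞` ⟹ the local condition at `𝔭` is `Γ_ℚ`-invariant**: if `res_{H ⊓ D_v} s = 0` (`H = Gal(ℚ̄/ℚ_∞)`,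
`v ∋ p`) then `res_{H ⊓ D_v}(conj_σ s) = 0` for EVERY `σ ∈ Γ_ℚ` — write `σ = δ·h` with `δ ∈ D_v` (decomposition group onto
`Gal(ℚ_∞/ℚ)`: `exists_apply_resGalOfEmb_adicCompletion_eq`) and `h ∈ H`; `conj_h = id` (`conjH1_of_mem_holds`) and `conj_δ`
preserves the condition (`resOfLe_conjH1_eq_zero_of_mem`). [cite: Kobayashi2003, §2 p. 4] [cite: Washington1997, §13.1] -/
theorem resOfLe_conjH1_eq_zero_of_isCyclotomic_rat (hκ : κ.IsCyclotomic) (v : HeightOneSpectrum (𝓞 ℚ))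
    (hv : ((p : ℕ) : 𝓞 ℚ) ∈ v.asIdeal) {s : W.subgroupH1 p κ.kerSubgroup}
    (hs : resOfLe (W.geomPrimaryTorsion p) (inf_le_left : κ.kerSubgroup ⊓ decomp v ≤ κ.kerSubgroup) s = 0)
    (σ : absoluteGaloisGroup ℚ) :
    resOfLe (W.geomPrimaryTorsion p) (inf_le_left : κ.kerSubgroup ⊓ decomp v ≤ κ.kerSubgroup)
      (W.conjH1 p κ.kerSubgroup σ s) = 0 := by
  obtain ⟨g, hg⟩ := hκ.exists_apply_resGalOfEmb_adicCompletion_eq v hv (κ σ)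
  set δ : absoluteGaloisGroup ℚ := resGalOfEmb (closureEmb (K := ℚ) (v.adicCompletion ℚ)) g with hδ
  have hδD : δ ∈ decomp (K := ℚ) v := resGalOfEmb_mem_decomp v g
  have hh : δ⁻¹ * σ ∈ κ.kerSubgroup := by
    rw [ZpExtension.mem_kerSubgroup, map_mul, map_inv, hg, inv_mul_cancel]
  have hσ : σ = δ * (δ⁻¹ * σ) := by rw [mul_inv_cancel_left]
  rw [hσ, W.conjH1_mul_holds p κ.kerSubgroup, AddMonoidHom.comp_apply, W.conjH1_of_mem_holds p κ.kerSubgroup hh,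
    AddMonoidHom.id_apply]
  exact FineSelmerCoefficientMap.resOfLe_conjH1_eq_zero_of_mem κ.kerSubgroup (decomp v) hδD hs

/-- **`Str_p(s) ⟺ res_{H ⊓ D_v} s = 0`** for `K = ℚ`, cyclotomic `κ`, `v ∋ p`: «`conj_σ s` lies in the strict kernel of the fine datum at
every place above `p`, for every `σ`» iff the single restriction of `s` to `Gal(ℚ̄/ℚ_∞) ⊓ D_v` vanishes.
[cite: Kobayashi2003, §2 p. 4, (7.17) (p. 12)] [cite: Greenberg1989, §1 p. 98] -/
theorem strictAt_iff_resOfLe_eq_zero_rat (hκ : κ.IsCyclotomic) (v : HeightOneSpectrum (𝓞 ℚ))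
    (hv : ((p : ℕ) : 𝓞 ℚ) ∈ v.asIdeal) (s : W.subgroupH1 p κ.kerSubgroup) :
    (∀ (v' : HeightOneSpectrum (𝓞 ℚ)) (hv' : ((p : ℕ) : 𝓞 ℚ) ∈ v'.asIdeal) (σ : absoluteGaloisGroup ℚ),
        conjH1 κ.kerSubgroup (W.geomPrimaryTorsion p) σ s ∈
          (fineData (W.geomPrimaryTorsion p) p v' hv').strictKer κ.kerSubgroup) ↔
      resOfLe (W.geomPrimaryTorsion p) (inf_le_left : κ.kerSubgroup ⊓ decomp v ≤ κ.kerSubgroup) s = 0 := by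
  constructor
  · intro h
    have h1 := (mem_strictKer_fineData_iff W p κ.kerSubgroup v hv _).1 (h v hv 1)
    rwa [show conjH1 κ.kerSubgroup (W.geomPrimaryTorsion p) 1 s = s from by
      rw [Literature.NumberTheory.EllipticCurves.conjH1_one_holds, AddMonoidHom.id_apply]] at h1
  · intro hs v' hv' σ
    obtain rfl : v = v' := heightOneSpectrum_eq_of_natCast_mem (Fact.out : p.Prime) hv hv'
    exact (mem_strictKer_fineData_iff W p κ.kerSubgroup v hv _).2
      (resOfLe_conjH1_eq_zero_of_isCyclotomic_rat W κ hκ v hv hs σ)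

/-! ## §4 The fine sandwich and its dual form in the one-condition currency -/

variable [W.IsElliptic] (ε : ℤˣ)

/-- **`K = ℚ`, cyclotomic `κ`: `s ∈ Sel^ε(E/ℚ_∞)` with `res_𝔭 s = 0` ⟹ `2 • s ∈ Sel₀(ℚ_∞, E[p^∞])`** (`…FineSandwich` + §3).
[cite: Kobayashi2003, Def. 1.1, (7.17)] [cite: GreenbergLNM1716, §2 Prop. 2.1] -/
theorem two_nsmul_mem_fineSelmerInfty_of_resOfLe_eq_zero_rat (hκ : κ.IsCyclotomic) (v : HeightOneSpectrum (𝓞 ℚ))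
    (hv : ((p : ℕ) : 𝓞 ℚ) ∈ v.asIdeal) {s : W.subgroupH1 p κ.kerSubgroup} (hs : s ∈ signedSelmerInfty W κ ε)
    (hres : resOfLe (W.geomPrimaryTorsion p) (inf_le_left : κ.kerSubgroup ⊓ decomp v ≤ κ.kerSubgroup) s = 0) :
    2 • s ∈ W.fineSelmerInfty κ :=
  FineSandwich.two_nsmul_mem_fineSelmerInfty_of_mem_signedSelmerInfty W κ ε hs
    ((strictAt_iff_resOfLe_eq_zero_rat W κ hκ v hv s).2 hres)

/-- **`K = ℚ`, cyclotomic `κ`, odd `p`: `Sel₀(ℚ_∞, E[p^∞]) = Sel^ε(E/ℚ_∞) ∩ ker res_𝔭`** as a membership criterion.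
[cite: Kobayashi2003, Def. 1.1, (7.17)] [cite: Greenberg1989, §1 p. 98] -/
theorem mem_fineSelmerInfty_iff_resOfLe_eq_zero_rat_of_odd (hp : Odd p) (hκ : κ.IsCyclotomic)
    (v : HeightOneSpectrum (𝓞 ℚ)) (hv : ((p : ℕ) : 𝓞 ℚ) ∈ v.asIdeal) (s : W.subgroupH1 p κ.kerSubgroup) :
    s ∈ W.fineSelmerInfty κ ↔ s ∈ signedSelmerInfty W κ ε ∧
      resOfLe (W.geomPrimaryTorsion p) (inf_le_left : κ.kerSubgroup ⊓ decomp v ≤ κ.kerSubgroup) s = 0 := by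
  rw [FineSandwich.mem_fineSelmerInfty_iff_of_odd W κ ε hp, strictAt_iff_resOfLe_eq_zero_rat W κ hκ v hv]

omit [W.IsElliptic] in
/-- The fine Selmer group is locally trivial at `𝔭` (any `p`). [cite: Greenberg1989, §1 p. 98] -/
theorem resOfLe_eq_zero_of_mem_fineSelmerInfty_rat (hκ : κ.IsCyclotomic) (v : HeightOneSpectrum (𝓞 ℚ))
    (hv : ((p : ℕ) : 𝓞 ℚ) ∈ v.asIdeal) {s : W.subgroupH1 p κ.kerSubgroup} (hs : s ∈ W.fineSelmerInfty κ) :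
    resOfLe (W.geomPrimaryTorsion p) (inf_le_left : κ.kerSubgroup ⊓ decomp v ≤ κ.kerSubgroup) s = 0 :=
  (strictAt_iff_resOfLe_eq_zero_rat W κ hκ v hv s).1 (FineSandwich.strict_of_mem_fineSelmerInfty W κ hs)

/-- **Dual form (pinned `D : SignedSelmerDualData W κ γ ε`, `K = ℚ`, cyclotomic `κ`)**: if `D.toDual x` vanishes on `Sel₀` (i.e.
`x ∈ ker (X^ε → X₀)`) then `D.toDual (2 • x)` vanishes on `Sel^ε ∩ ker res_𝔭` — `2 • x` is a character of the image of
`Sel^ε(E/ℚ_∞)` in the ONE local cohomology group `H¹(ℚ_{∞,𝔭}, E[p^∞])`. This is the LOCAL COVER hypothesis of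
`SignedKatoOffTwo.signedKatoDivisibilityUpToAtTwo_of_localRobustPackageTwo_of_pub` in its final currency.
[cite: Kobayashi2003, (7.17)–(7.21) (pp. 12–13)] -/
theorem toDual_two_nsmul_apply_eq_zero_of_resOfLe_eq_zero_rat (hκ : κ.IsCyclotomic) (v : HeightOneSpectrum (𝓞 ℚ))
    (hv : ((p : ℕ) : 𝓞 ℚ) ∈ v.asIdeal) {γ : absoluteGaloisGroup ℚ} (D : SignedSelmerDualData W κ γ ε) (x : D.X)
    (hx : ∀ t : W.fineSelmerInfty κ,
      D.toDual x (AddSubgroup.inclusion (fineSelmerInfty_le_signedSelmerInfty W κ ε) t) = 0)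
    (s : signedSelmerInfty W κ ε)
    (hres : resOfLe (W.geomPrimaryTorsion p) (inf_le_left : κ.kerSubgroup ⊓ decomp v ≤ κ.kerSubgroup)
      (s : W.subgroupH1 p κ.kerSubgroup) = 0) :
    D.toDual (2 • x) s = 0 :=
  FineSandwich.toDual_two_nsmul_apply_eq_zero W κ ε D x hx s
    ((strictAt_iff_resOfLe_eq_zero_rat W κ hκ v hv _).2 hres)

omit [W.IsElliptic] in
/-- The local-cover hypothesis in the one-condition currency implies the one of `…OffTwoLocalPackage` (which quantifies the
strict condition over all places above `p` and all conjugates): for `K = ℚ`, cyclotomic `κ`, a statement about characters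
vanishing on `Sel^ε ∩ ker res_𝔭` yields the statement about characters vanishing on `Sel^ε ∩ Str_p`. [folklore] -/
theorem localCover_of_localCover_resOfLe_rat (hκ : κ.IsCyclotomic) (v : HeightOneSpectrum (𝓞 ℚ))
    (hv : ((p : ℕ) : 𝓞 ℚ) ∈ v.asIdeal) {γ : absoluteGaloisGroup ℚ} (D : SignedSelmerDualData W κ γ ε)
    {P : Prop} (x : D.X)
    (h : (∀ t : signedSelmerInfty W κ ε,
        resOfLe (W.geomPrimaryTorsion p) (inf_le_left : κ.kerSubgroup ⊓ decomp v ≤ κ.kerSubgroup)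
          (t : W.subgroupH1 p κ.kerSubgroup) = 0 → D.toDual x t = 0) → P)
    (hx : ∀ t : signedSelmerInfty W κ ε,
      (∀ (v' : HeightOneSpectrum (𝓞 ℚ)) (hv' : ((p : ℕ) : 𝓞 ℚ) ∈ v'.asIdeal) (σ : absoluteGaloisGroup ℚ),
        conjH1 κ.kerSubgroup (W.geomPrimaryTorsion p) σ (t : W.subgroupH1 p κ.kerSubgroup) ∈
          (fineData (W.geomPrimaryTorsion p) p v' hv').strictKer κ.kerSubgroup) →
      D.toDual x t = 0) : P :=
  h fun t ht ↦ hx t ((strictAt_iff_resOfLe_eq_zero_rat W κ hκ v hv _).2 ht)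

end Rat

end SignedKatoOffTwo.FineStrictRat

end Summit.BirchSwinnertonDyer.BirchSwinnertonDyer.Theorems

end
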